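import Summits.QuantumFields.QCD.Theses.HeatSlicedQuarks
import Summits.QuantumFields.QCD.Theorems.HeatSlicedQuarksSmallFieldUltracontractivity
import Summits.QuantumFields.QCD.Theorems.HeatSlicedQuarksActionBoundsLowModes

/-!
# The crux `InterleavedHeatSliceFlow` has collapsed onto the route target `ContinuumQCDExists`

Route `HeatSlicedQuarks` (sub-problem QCD), crux item stmt-QuantumFields-8891:
`InterleavedHeatSliceFlow := SmallFieldUltracontractivity → ActionBoundsLowModes → ContinuumQCDExists`.

Both antecedents are now THEOREMS of the tree:

* `SmallFieldUltracontractivity` (item stmt-QuantumFields-8871) —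
  `Cruxes.SmallFieldUltracontractivity.PointCentredAxialParabolic.SmallFieldUltracontractivity_of`
  (`Theorems/HeatSlicedQuarksSmallFieldUltracontractivity.lean`);
* `ActionBoundsLowModes` (item stmt-QuantumFields-8872) —
  `Cruxes.ActionBoundsLowModes.DropTheWilsonSquare.ActionBoundsLowModes_of`
  (`Theorems/HeatSlicedQuarksActionBoundsLowModes.lean`).

Hence, by modus ponens, the crux is EQUIVALENT to the route target X₀ = `ContinuumQCDExists`
(item stmt-QuantumFields-8870: continuum QCD for `N_f = 2, 3` as OS data along an asymptotically free
Wilson scheme, non-trivial and non-Gaussian glue, non-trivial flavour-changing pseudoscalars) — recorded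
here as `interleavedHeatSliceFlow_iff_continuumQCDExists`.  Consequences for the route's bookkeeping
(pure logic, all decls by name):

* every line for crux 8891 has a transfer stub equal in strength to X₀ itself (the disprover's
  `crux_iff_target`, `Cruxes/InterleavedHeatSliceFlow/Disproof.lean` §1, with its two hypotheses now
  discharged);
* the route's `Assembly` (item stmt-QuantumFields-8878) is equivalent to `RobustYangMillsHandover`
  (item stmt-QuantumFields-8892), `assembly_iff_robustYangMillsHandover`;
* the sub-problem statement `QCD` follows from X₀ and the handover alone, `qcd_of_target_of_handover`.

Nothing here is new mathematics; the file exists so that the ledger sees the collapse as kernel-checked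
theorems rather than prose.  No named facts; axioms are those of the two imported crux proofs.
-/

namespace Summit.QuantumFields.QCD.Cruxes.InterleavedHeatSliceFlow

open Summit.QuantumFields.QCD.Theses.HeatSlicedQuarks

/-- The target gives the crux (trivially: the crux is an implication INTO the target). -/
theorem interleavedHeatSliceFlow_of_continuumQCDExists (hX : ContinuumQCDExists) :
    InterleavedHeatSliceFlow :=
  fun _ _ => hX

/-- The crux gives the target: both spectral antecedents are proved in the tree
(`SmallFieldUltracontractivity_of`, item 8871; `ActionBoundsLowModes_of`, item 8872). -/
theorem continuumQCDExists_of_interleavedHeatSliceFlow (h : InterleavedHeatSliceFlow) :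
    ContinuumQCDExists :=
  h SmallFieldUltracontractivity.PointCentredAxialParabolic.SmallFieldUltracontractivity_of
    ActionBoundsLowModes.DropTheWilsonSquare.ActionBoundsLowModes_of

/-- **Collapse.** With items 8871 and 8872 closed, the crux `InterleavedHeatSliceFlow` (item 8891) is
equivalent to the route target `ContinuumQCDExists` (item 8870). -/
theorem interleavedHeatSliceFlow_iff_continuumQCDExists :
    InterleavedHeatSliceFlow ↔ ContinuumQCDExists :=
  ⟨continuumQCDExists_of_interleavedHeatSliceFlow, interleavedHeatSliceFlow_of_continuumQCDExists⟩

/-- The two spectral cruxes hold outright, so the route's `Assembly`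
(`SmallFieldUltracontractivity → ActionBoundsLowModes → ContinuumQCDExists → QCD`, item 8878) is
equivalent to the handover `RobustYangMillsHandover := ContinuumQCDExists → QCD` (item 8892). -/
theorem assembly_iff_robustYangMillsHandover : Assembly ↔ RobustYangMillsHandover :=
  ⟨fun hA => hA SmallFieldUltracontractivity.PointCentredAxialParabolic.SmallFieldUltracontractivity_of
      ActionBoundsLowModes.DropTheWilsonSquare.ActionBoundsLowModes_of,
    fun hH _ _ => hH⟩

/-- What is left of the route after the collapse: the sub-problem `QCD` follows from the target X₀
(item 8870) and the handover (item 8892) alone — the route's deciding theorem `closes` with its two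
proved hypotheses supplied. -/
theorem qcd_of_target_of_handover (hX : ContinuumQCDExists) (hH : RobustYangMillsHandover) :
    _root_.QCD :=
  -- buildfix 2026-08-19: the route's `closes` was re-cut (rev 7/10: TracedQuadraticParametrix,
  -- QuarkLoopCoefficient, InterleavedFlowProper inserted); the handover is literally
  -- `ContinuumQCDExists → QCD`, so it is applied directly.
  hH hX

end Summit.QuantumFields.QCD.Cruxes.InterleavedHeatSliceFlow

namespace Summit.QuantumFields.QCD.Cruxes.InterleavedHeatSliceFlow.Sketch

open Summit.QuantumFields.QCD.Theses.HeatSlicedQuarks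

/-- **Stub `stub_collapse` of line `Sketch`** (registered on item stmt-QuantumFields-8891, reshape r3): the
crux is equivalent to the route target, by `interleavedHeatSliceFlow_iff_continuumQCDExists`. -/
theorem stub_collapse :
    Summit.QuantumFields.QCD.Theses.HeatSlicedQuarks.InterleavedHeatSliceFlow ↔ ContinuumQCDExists :=
  interleavedHeatSliceFlow_iff_continuumQCDExists

end Summit.QuantumFields.QCD.Cruxes.InterleavedHeatSliceFlow.Sketch
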